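import Mathlib.Analysis.SpecialFunctions.PolarCoord
import Mathlib.MeasureTheory.Function.JacobianOneDim
import Literature.Probability.Distributions.StdGaussianFibre
import Literature.Analysis.FluidPDE.DicedHardSphereDynamics
import Literature.MathematicalPhysics.KineticTheory.LambertianRedrawNondegenerate
import HarnessLib

/-!
# The standard Gaussian of `ℝ³` in cylindrical coordinates about a contact normal
# (`LambertianContactSwap.LambertianEuler`, stmt-AtomisticToContinuum-11854, line `Sketch`;
# helper file for the stubs `stub_lambertLaw`, `stub_archimedes`)

Kinematics of the route's cosine redraw `lambertDir ω ξ = normalize(ω̂ + ξ̂)` in the orthonormal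
frame `(e₁ ω, e₂ ω, ω)` of `DicedHardSphereDynamics.Lambert` and the disintegration of the
standard Gaussian `γ` of `ℝ³` that the Lambert-law computation consumes:

* `unitVec_eq`, `inner_unitVec_eq`, `lambertDir_frame` — for `ξ = c ω + r u` (`u` a unit vector
  of `ω^⊥`, `r > 0`), with `t = c/√(c² + r²)`: `ξ̂ = t ω + √(1−t²) u` and
  `lambertDir ω ξ = √((1+t)/2) ω + √((1−t)/2) u` (the cosine redraw HALVES the polar angle);
* `setLIntegral_comp_halfAngle` — the substitution `t = 2s² − 1`:
  `∫_{[-1,1]} K(√((1+t)/2)) dt = ∫_{[-1,1]} 4 t₊ K(t) dt`;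
* `lintegral_stdGaussian_two_coords`, `lintegral_stdGaussian_frame` — two/three orthonormal
  coordinates of `γ` are independent standard Gaussians (fibre decomposition
  `Literature.Probability.Distributions.stdGaussian_eq_map_fibre`, applied twice/thrice);
* `lintegral_gaussianReal_prod_polar`, `lintegral_stdGaussian_framePolar` — polar coordinates in
  the plane `ω^⊥` (`lintegral_comp_polarCoord_symm`):
  `∫ H dγ = ∫ dγ₁(c) ∫_{r>0} ∫_{θ} r (2π)⁻¹ e^{-r²/2} H(c ω + r u_θ)`, `u_θ = cos θ e₁ + sin θ e₂`.

All [folklore].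
-/

noncomputable section

open MeasureTheory ProbabilityTheory Set Real Filter
open scoped ENNReal InnerProductSpace

namespace Summit.AtomisticToContinuum.HydrodynamicLimit.Theorems.LambertianContactSwapLambertianEulerGaussianFrame

open Literature.MathematicalPhysics.KineticTheory Literature.Analysis.FluidPDE

/-! ### Algebra of the cosine redraw in an adapted frame -/

/-- The meridian point of the unit sphere at height `s` above the plane `ω^⊥` in the azimuth `u`:
`Ψ u s = s ω + √(1 − s²) u` (local notation of this file, as a plain expression). For orthonormal
`ω, u`, real `c` and `r > 0`, with `ρ = √(c² + r²)` and `t = c/ρ`: the unit vector of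
`ξ = c ω + r u` is `t ω + √(1−t²) u`. [folklore] -/
theorem unitVec_eq {ω u : V3} (hω : ‖ω‖ = 1) (hu : ‖u‖ = 1) (hωu : ⟪ω, u⟫_ℝ = 0) (c : ℝ) {r : ℝ}
    (hr : 0 < r) :
    ‖c • ω + r • u‖⁻¹ • (c • ω + r • u) =
      (c / √(c ^ 2 + r ^ 2)) • ω + √(1 - (c / √(c ^ 2 + r ^ 2)) ^ 2) • u := by
  have hρ2 : ‖c • ω + r • u‖ ^ 2 = c ^ 2 + r ^ 2 := by
    rw [norm_add_sq_real, norm_smul, norm_smul, hω, hu, inner_smul_left, inner_smul_right, hωu]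
    simp [Real.norm_eq_abs, sq_abs]
  have hpos : 0 < c ^ 2 + r ^ 2 := by positivity
  have hρ : ‖c • ω + r • u‖ = √(c ^ 2 + r ^ 2) := by
    rw [← hρ2, Real.sqrt_sq (norm_nonneg _)]
  have hsqrt_pos : 0 < √(c ^ 2 + r ^ 2) := Real.sqrt_pos.2 hpos
  have hsq : √(1 - (c / √(c ^ 2 + r ^ 2)) ^ 2) = r / √(c ^ 2 + r ^ 2) := by
    have h1 : 1 - (c / √(c ^ 2 + r ^ 2)) ^ 2 = (r / √(c ^ 2 + r ^ 2)) ^ 2 := by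
      rw [div_pow, div_pow, Real.sq_sqrt hpos.le]
      field_simp
      ring
    rw [h1, Real.sqrt_sq (div_nonneg hr.le hsqrt_pos.le)]
  rw [hsq, hρ, smul_add, smul_smul, smul_smul, div_eq_inv_mul, div_eq_inv_mul]

/-- The polar cosine of `ξ = c ω + r u` about `ω` is `t = c/√(c² + r²)` (orthonormal `ω, u`,
`r > 0`). [folklore] -/
theorem inner_unitVec_eq {ω u : V3} (hω : ‖ω‖ = 1) (hu : ‖u‖ = 1) (hωu : ⟪ω, u⟫_ℝ = 0) (c : ℝ)
    {r : ℝ} (hr : 0 < r) :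
    ⟪ω, ‖c • ω + r • u‖⁻¹ • (c • ω + r • u)⟫_ℝ = c / √(c ^ 2 + r ^ 2) := by
  rw [unitVec_eq hω hu hωu c hr, inner_add_right, inner_smul_right, inner_smul_right,
    real_inner_self_eq_norm_sq, hω, hωu]
  ring

/-- `|t| < 1` for the polar cosine `t = c/√(c² + r²)` when `r > 0`. [folklore] -/
theorem polarCos_sq_lt_one (c : ℝ) {r : ℝ} (hr : 0 < r) : (c / √(c ^ 2 + r ^ 2)) ^ 2 < 1 := by
  have hpos : 0 < c ^ 2 + r ^ 2 := by positivity
  rw [div_pow, Real.sq_sqrt hpos.le, div_lt_one hpos]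
  nlinarith

/-- **The cosine redraw halves the polar angle**: for orthonormal `ω, u`, real `c` and `r > 0`,
with `t = c/√(c² + r²)`,
`lambertDir ω (c ω + r u) = √((1+t)/2) ω + √(1 − (√((1+t)/2))²) u` (`= √((1+t)/2) ω + √((1−t)/2) u`).
[cite: CometsEtAl2008, §2.1] -/
theorem lambertDir_frame {ω u : V3} (hω : ‖ω‖ = 1) (hu : ‖u‖ = 1) (hωu : ⟪ω, u⟫_ℝ = 0) (c : ℝ)
    {r : ℝ} (hr : 0 < r) :
    lambertDir ω (c • ω + r • u) =
      √((1 + c / √(c ^ 2 + r ^ 2)) / 2) • ω +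
        √(1 - (√((1 + c / √(c ^ 2 + r ^ 2)) / 2)) ^ 2) • u := by
  set t : ℝ := c / √(c ^ 2 + r ^ 2) with ht
  have ht1 : t ^ 2 < 1 := polarCos_sq_lt_one c hr
  have ht1' : -1 < t := (abs_lt.1 ((sq_lt_one_iff_abs_lt_one t).1 ht1)).1
  have hpos : 0 < 1 + t := by linarith
  have hω1 : ‖ω‖⁻¹ • ω = ω := by rw [hω, inv_one, one_smul]
  -- the bisector `ω + ξ̂ = (1+t) ω + √(1-t²) u` and its norm `√(2(1+t))`
  have hb : ‖ω‖⁻¹ • ω + ‖c • ω + r • u‖⁻¹ • (c • ω + r • u) = (1 + t) • ω + √(1 - t ^ 2) • u := by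
    rw [hω1, unitVec_eq hω hu hωu c hr, ← ht, ← add_assoc, add_smul, one_smul]
  have hbn2 : ‖(1 + t) • ω + √(1 - t ^ 2) • u‖ ^ 2 = 2 * (1 + t) := by
    rw [norm_add_sq_real, norm_smul, norm_smul, hω, hu, inner_smul_left, inner_smul_right, hωu,
      Real.norm_eq_abs, Real.norm_eq_abs, abs_of_pos hpos,
      abs_of_nonneg (Real.sqrt_nonneg _), mul_one, mul_one, Real.sq_sqrt (by nlinarith)]
    ring
  have hbn : ‖(1 + t) • ω + √(1 - t ^ 2) • u‖ = √(2 * (1 + t)) := by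
    rw [← hbn2, Real.sqrt_sq (norm_nonneg _)]
  have hs_pos : 0 < √(2 * (1 + t)) := Real.sqrt_pos.2 (by linarith)
  -- the two coefficients
  have hc1 : (√(2 * (1 + t)))⁻¹ * (1 + t) = √((1 + t) / 2) := by
    have e : (1 + t) / 2 = ((√(2 * (1 + t)))⁻¹ * (1 + t)) ^ 2 := by
      rw [mul_pow, inv_pow, Real.sq_sqrt (by positivity)]
      field_simp
    rw [e, Real.sqrt_sq (by positivity)]
  have hc2 : (√(2 * (1 + t)))⁻¹ * √(1 - t ^ 2) = √(1 - (√((1 + t) / 2)) ^ 2) := by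
    rw [Real.sq_sqrt (by positivity : 0 ≤ (1 + t) / 2), ← Real.sqrt_inv,
      ← Real.sqrt_mul (inv_nonneg.2 (by positivity))]
    congr 1
    field_simp
    ring
  rw [lambertDir, hb, hbn, smul_add, smul_smul, smul_smul, hc1, hc2]

/-! ### The substitution `t = 2s² − 1` -/

/-- **The half-angle substitution.** For measurable `K ≥ 0`:
`∫_{[-1,1]} K(√((1+t)/2)) dt = ∫_{[-1,1]} 4 t₊ K(t) dt` (`t = 2s² − 1`, `dt = 4s ds` on `[0,1]`;
the weight kills `[-1, 0]`). This is the identity "the law of `cos(ϑ/2)` for `cos ϑ` uniform is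
`2s ds`", i.e. the one-dimensional content of the cosine law. [folklore] -/
theorem setLIntegral_comp_halfAngle (K : ℝ → ℝ≥0∞) :
    ∫⁻ t in Icc (-1 : ℝ) 1, K (√((1 + t) / 2)) =
      ∫⁻ t in Icc (-1 : ℝ) 1, ENNReal.ofReal (4 * max t 0) * K t := by
  -- right side: only `(0, 1]` contributes
  have hR : ∫⁻ t in Icc (-1 : ℝ) 1, ENNReal.ofReal (4 * max t 0) * K t =
      ∫⁻ t in Ioc (0 : ℝ) 1, ENNReal.ofReal (4 * t) * K t := by
    have hsplit : Icc (-1 : ℝ) 1 = Icc (-1 : ℝ) 0 ∪ Ioc 0 1 := by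
      rw [Icc_union_Ioc_eq_Icc] <;> norm_num
    rw [hsplit, lintegral_union measurableSet_Ioc]
    · have h0 : ∫⁻ t in Icc (-1 : ℝ) 0, ENNReal.ofReal (4 * max t 0) * K t = 0 := by
        refine (setLIntegral_congr_fun measurableSet_Icc fun t ht => ?_).trans lintegral_zero
        rw [max_eq_right ht.2, mul_zero, ENNReal.ofReal_zero, zero_mul]
      rw [h0, zero_add]
      exact setLIntegral_congr_fun measurableSet_Ioc fun t ht => by rw [max_eq_left ht.1.le]
    · rw [Set.disjoint_iff]
      rintro t ⟨h1, h2⟩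
      exact (lt_irrefl (0 : ℝ)) (h2.1.trans_le h1.2)
  -- left side: the substitution `t = f s = 2 s² - 1`, `s ∈ [0, 1]`
  set f : ℝ → ℝ := fun s => 2 * s ^ 2 - 1 with hf
  have himage : f '' Icc (0 : ℝ) 1 = Icc (-1 : ℝ) 1 := by
    apply Set.Subset.antisymm
    · rintro _ ⟨s, ⟨hs0, hs1⟩, rfl⟩
      refine ⟨?_, ?_⟩ <;> simp only [hf] <;> nlinarith
    · rintro t ⟨ht0, ht1⟩
      refine ⟨√((1 + t) / 2), ⟨Real.sqrt_nonneg _, ?_⟩, ?_⟩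
      · rw [Real.sqrt_le_one]
        linarith
      · simp only [hf]
        rw [Real.sq_sqrt (by linarith)]
        ring
  have hderiv : ∀ s ∈ Icc (0 : ℝ) 1, HasDerivWithinAt f (4 * s) (Icc (0 : ℝ) 1) s := by
    intro s _
    have h : HasDerivAt f (2 * (((2 : ℕ) : ℝ) * s ^ (2 - 1))) s :=
      ((hasDerivAt_pow 2 s).const_mul 2).sub_const 1
    exact h.hasDerivWithinAt.congr_deriv (by norm_num; ring)
  have hinj : InjOn f (Icc (0 : ℝ) 1) := by
    intro a ha b hb hab
    simp only [hf] at hab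
    have : a ^ 2 = b ^ 2 := by linarith
    exact (sq_eq_sq₀ ha.1 hb.1).1 this
  have hcov := lintegral_image_eq_lintegral_abs_deriv_mul measurableSet_Icc hderiv hinj
    (fun t => K (√((1 + t) / 2)))
  rw [himage] at hcov
  rw [hcov, hR, ← Measure.restrict_congr_set Ioc_ae_eq_Icc]
  refine setLIntegral_congr_fun measurableSet_Ioc fun s hs => ?_
  have hs0 : 0 ≤ s := hs.1.le
  simp only [hf]
  rw [abs_of_nonneg (by linarith : 0 ≤ 4 * s)]
  congr 2
  have : (1 + (2 * s ^ 2 - 1)) / 2 = s ^ 2 := by ring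
  rw [this, Real.sqrt_sq hs0]

/-! ### The standard Gaussian of `ℝ³` in an adapted frame -/

/-- **Two orthonormal coordinates of a standard Gaussian vector are independent standard
Gaussians**: for orthonormal `e₁, e₂` and measurable `M ≥ 0`,
`∫ M(⟪e₁, z⟫, ⟪e₂, z⟫) dγ(z) = ∫∫ M(a, b) dγ₁(a) dγ₁(b)` (two applications of the fibre
decomposition `stdGaussian_eq_map_fibre`). [folklore] -/
theorem lintegral_stdGaussian_two_coords {e₁ e₂ : V3} (h1 : ‖e₁‖ = 1) (h2 : ‖e₂‖ = 1)
    (h12 : ⟪e₁, e₂⟫_ℝ = 0) {M : ℝ × ℝ → ℝ≥0∞} (hM : Measurable M) :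
    ∫⁻ z, M (⟪e₁, z⟫_ℝ, ⟪e₂, z⟫_ℝ) ∂(stdGaussian V3) =
      ∫⁻ a, ∫⁻ b, M (a, b) ∂(gaussianReal 0 1) ∂(gaussianReal 0 1) := by
  have hm1 : Measurable fun z : V3 => M (⟪e₁, z⟫_ℝ, ⟪e₂, z⟫_ℝ) :=
    hM.comp ((continuous_const.inner continuous_id).measurable.prodMk
      (continuous_const.inner continuous_id).measurable)
  rw [Literature.Probability.Distributions.lintegral_stdGaussian_fibre h1 hm1]
  refine lintegral_congr fun a => ?_
  have h11 : ⟪e₁, e₁⟫_ℝ = 1 := by rw [real_inner_self_eq_norm_sq, h1, one_pow]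
  have h21 : ⟪e₂, e₁⟫_ℝ = 0 := by rw [real_inner_comm, h12]
  have hfst : ∀ w : V3, ⟪e₁, a • e₁ + (w - ⟪w, e₁⟫_ℝ • e₁)⟫_ℝ = a := by
    intro w
    rw [inner_add_right, inner_sub_right, inner_smul_right, inner_smul_right, h11,
      real_inner_comm e₁ w]
    ring
  have hsnd : ∀ w : V3, ⟪e₂, a • e₁ + (w - ⟪w, e₁⟫_ℝ • e₁)⟫_ℝ = ⟪e₂, w⟫_ℝ := by
    intro w
    rw [inner_add_right, inner_sub_right, inner_smul_right, inner_smul_right, h21]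
    ring
  simp_rw [hfst, hsnd]
  -- the law of `⟪e₂, w⟫` under `γ` is `γ₁`
  have hm2 : Measurable fun w : V3 => M (a, ⟪e₂, w⟫_ℝ) :=
    hM.comp (measurable_const.prodMk (continuous_const.inner continuous_id).measurable)
  rw [Literature.Probability.Distributions.lintegral_stdGaussian_fibre h2 hm2]
  refine lintegral_congr fun b => ?_
  have h22 : ⟪e₂, e₂⟫_ℝ = 1 := by rw [real_inner_self_eq_norm_sq, h2, one_pow]
  have hb : ∀ w : V3, ⟪e₂, b • e₂ + (w - ⟪w, e₂⟫_ℝ • e₂)⟫_ℝ = b := by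
    intro w
    rw [inner_add_right, inner_sub_right, inner_smul_right, inner_smul_right, h22,
      real_inner_comm e₂ w]
    ring
  simp_rw [hb]
  rw [lintegral_const, measure_univ, mul_one]

/-- The orthogonal projection onto `ω^⊥` in the frame `(e₁ ω, e₂ ω)` of
`DicedHardSphereDynamics.Lambert` (unit `ω`): `z − ⟪z, ω⟫ ω = ⟪e₁ ω, z⟫ e₁ ω + ⟪e₂ ω, z⟫ e₂ ω`.
[folklore] -/
theorem proj_eq_frame {ω : V3} (hω : ‖ω‖ = 1) (z : V3) :
    z - ⟪z, ω⟫_ℝ • ω = ⟪Lambert.e₁ ω, z⟫_ℝ • Lambert.e₁ ω + ⟪Lambert.e₂ ω, z⟫_ℝ • Lambert.e₂ ω := by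
  have h := Lambert.embed_coords hω z
  rw [real_inner_comm ω z, ← h]
  simp [Lambert.embed, Lambert.coords]

/-- **The standard Gaussian of `ℝ³` in an adapted orthonormal frame**: for a unit vector `ω`
and measurable `H ≥ 0`, `∫ H dγ = ∫∫∫ H(c ω + a e₁ + b e₂) dγ₁(b) dγ₁(a) dγ₁(c)` with the frame
`(e₁ ω, e₂ ω, ω)`. [folklore] -/
theorem lintegral_stdGaussian_frame {ω : V3} (hω : ‖ω‖ = 1) {H : V3 → ℝ≥0∞}
    (hH : Measurable H) :
    ∫⁻ ξ, H ξ ∂(stdGaussian V3) =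
      ∫⁻ c, ∫⁻ a, ∫⁻ b, H (c • ω + (a • Lambert.e₁ ω + b • Lambert.e₂ ω))
        ∂(gaussianReal 0 1) ∂(gaussianReal 0 1) ∂(gaussianReal 0 1) := by
  rw [Literature.Probability.Distributions.lintegral_stdGaussian_fibre hω hH]
  refine lintegral_congr fun c => ?_
  simp_rw [proj_eq_frame hω]
  have hM : Measurable fun q : ℝ × ℝ => H (c • ω + (q.1 • Lambert.e₁ ω + q.2 • Lambert.e₂ ω)) :=
    hH.comp (by fun_prop)
  exact lintegral_stdGaussian_two_coords (Lambert.norm_e₁ ω) (Lambert.norm_e₂ hω)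
    (Lambert.inner_e₁_e₂ ω) hM

/-! ### The planar Gaussian in polar coordinates -/

/-- The product of two standard Gaussian densities at a point of polar coordinates `(r, θ)` is
`(2π)⁻¹ e^{-r²/2}`. [folklore] -/
theorem gaussianPDF_mul_gaussianPDF_polar (r θ : ℝ) :
    gaussianPDF 0 1 (r * cos θ) * gaussianPDF 0 1 (r * sin θ) =
      ENNReal.ofReal ((2 * π)⁻¹ * rexp (-r ^ 2 / 2)) := by
  rw [gaussianPDF, gaussianPDF, gaussianPDFReal, gaussianPDFReal,
    ← ENNReal.ofReal_mul (by positivity)]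
  congr 1
  have hs : (√(2 * π * ((1 : NNReal) : ℝ)))⁻¹ * (√(2 * π * ((1 : NNReal) : ℝ)))⁻¹ = (2 * π)⁻¹ := by
    rw [NNReal.coe_one, mul_one, ← mul_inv, Real.mul_self_sqrt (by positivity)]
  have he : rexp (-(r * cos θ - 0) ^ 2 / (2 * ((1 : NNReal) : ℝ))) *
      rexp (-(r * sin θ - 0) ^ 2 / (2 * ((1 : NNReal) : ℝ))) = rexp (-r ^ 2 / 2) := by
    rw [← Real.exp_add]
    congr 1
    rw [NNReal.coe_one, sub_zero, sub_zero]
    have := Real.cos_sq_add_sin_sq θ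
    field_simp
    nlinarith [this]
  calc (√(2 * π * ((1 : NNReal) : ℝ)))⁻¹ * rexp (-(r * cos θ - 0) ^ 2 / (2 * ((1 : NNReal) : ℝ))) *
        ((√(2 * π * ((1 : NNReal) : ℝ)))⁻¹ * rexp (-(r * sin θ - 0) ^ 2 / (2 * ((1 : NNReal) : ℝ))))
      = ((√(2 * π * ((1 : NNReal) : ℝ)))⁻¹ * (√(2 * π * ((1 : NNReal) : ℝ)))⁻¹) *
          (rexp (-(r * cos θ - 0) ^ 2 / (2 * ((1 : NNReal) : ℝ))) *
            rexp (-(r * sin θ - 0) ^ 2 / (2 * ((1 : NNReal) : ℝ)))) := by ring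
    _ = (2 * π)⁻¹ * rexp (-r ^ 2 / 2) := by rw [hs, he]

/-- **The planar standard Gaussian in polar coordinates**: for measurable `K ≥ 0`,
`∫∫ K(a, b) dγ₁(b) dγ₁(a) = ∫_{r>0} ∫_{θ ∈ (-π,π)} r (2π)⁻¹ e^{-r²/2} K(r cos θ, r sin θ) dθ dr`.
[folklore] -/
theorem lintegral_gaussianReal_prod_polar {K : ℝ × ℝ → ℝ≥0∞} (hK : Measurable K) :
    ∫⁻ a, ∫⁻ b, K (a, b) ∂(gaussianReal 0 1) ∂(gaussianReal 0 1) =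
      ∫⁻ r in Ioi (0 : ℝ), ∫⁻ θ in Ioo (-π) π,
        ENNReal.ofReal (r * ((2 * π)⁻¹ * rexp (-r ^ 2 / 2))) * K (r * cos θ, r * sin θ) := by
  have hφ : Measurable (gaussianPDF 0 1) := measurable_gaussianPDF 0 1
  have hd : Measurable fun z : ℝ × ℝ => gaussianPDF 0 1 z.1 * gaussianPDF 0 1 z.2 :=
    (hφ.comp measurable_fst).mul (hφ.comp measurable_snd)
  have hps : Measurable fun p : ℝ × ℝ => polarCoord.symm p := by
    have : (fun p : ℝ × ℝ => polarCoord.symm p) = fun p => (p.1 * cos p.2, p.1 * sin p.2) :=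
      funext fun p => polarCoord_symm_apply p
    rw [this]
    fun_prop
  rw [← lintegral_prod _ hK.aemeasurable, gaussianReal_of_var_ne_zero 0 one_ne_zero,
    prod_withDensity hφ hφ, ← Measure.volume_eq_prod,
    lintegral_withDensity_eq_lintegral_mul _ hd hK,
    ← lintegral_comp_polarCoord_symm, polarCoord_target, Measure.volume_eq_prod,
    ← Measure.prod_restrict, lintegral_prod]
  · refine setLIntegral_congr_fun measurableSet_Ioi fun r hr => ?_
    refine setLIntegral_congr_fun measurableSet_Ioo fun θ _ => ?_
    simp only [polarCoord_symm_apply, Pi.mul_apply, smul_eq_mul]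
    rw [gaussianPDF_mul_gaussianPDF_polar, ← mul_assoc, ← ENNReal.ofReal_mul (le_of_lt hr)]
  · exact ((ENNReal.measurable_ofReal.comp measurable_fst).smul ((hd.mul hK).comp hps)).aemeasurable

/-- **The standard Gaussian of `ℝ³` in cylindrical coordinates about a unit vector `ω`**:
`∫ H dγ = ∫ dγ₁(c) ∫_{r>0} ∫_{θ∈(-π,π)} r (2π)⁻¹ e^{-r²/2} H(c ω + r u_θ) dθ dr` with the azimuth
`u_θ = cos θ e₁ ω + sin θ e₂ ω`. [folklore] -/
theorem lintegral_stdGaussian_framePolar {ω : V3} (hω : ‖ω‖ = 1) {H : V3 → ℝ≥0∞}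
    (hH : Measurable H) :
    ∫⁻ ξ, H ξ ∂(stdGaussian V3) =
      ∫⁻ c : ℝ, (∫⁻ r in Ioi (0 : ℝ), ∫⁻ θ in Ioo (-π) π,
        ENNReal.ofReal (r * ((2 * π)⁻¹ * rexp (-r ^ 2 / 2))) *
          H (c • ω + r • (Real.cos θ • Lambert.e₁ ω + Real.sin θ • Lambert.e₂ ω)))
            ∂(gaussianReal 0 1) := by
  rw [lintegral_stdGaussian_frame hω hH]
  refine lintegral_congr fun c => ?_
  have hK : Measurable fun q : ℝ × ℝ => H (c • ω + (q.1 • Lambert.e₁ ω + q.2 • Lambert.e₂ ω)) :=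
    hH.comp (by fun_prop)
  rw [lintegral_gaussianReal_prod_polar hK]
  refine setLIntegral_congr_fun measurableSet_Ioi fun r _ => ?_
  refine setLIntegral_congr_fun measurableSet_Ioo fun θ _ => ?_
  rw [smul_add, smul_smul, smul_smul]

/-- Splitting of the polar weight: `r (k E) · X = (r E) · (k · X)` in `ℝ≥0∞` for `r E ≥ 0`.
[folklore] -/
theorem ofReal_weight_mul {r E : ℝ} (k : ℝ) (hrE : 0 ≤ r * E) (X : ℝ≥0∞) :
    ENNReal.ofReal (r * (k * E)) * X = ENNReal.ofReal (r * E) * (ENNReal.ofReal k * X) := by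
  rw [show r * (k * E) = r * E * k by ring, ENNReal.ofReal_mul hrE, mul_assoc]

/-- The azimuth unit vector `u_θ = cos θ e₁ ω + sin θ e₂ ω` has norm `1` (unit `ω`). [folklore] -/
theorem norm_azimuth {ω : V3} (hω : ‖ω‖ = 1) (θ : ℝ) :
    ‖cos θ • Lambert.e₁ ω + sin θ • Lambert.e₂ ω‖ = 1 := by
  have h2 : ‖cos θ • Lambert.e₁ ω + sin θ • Lambert.e₂ ω‖ ^ 2 = 1 := by
    rw [norm_add_sq_real, norm_smul, norm_smul, Lambert.norm_e₁, Lambert.norm_e₂ hω,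
      inner_smul_left, inner_smul_right, Lambert.inner_e₁_e₂, Real.norm_eq_abs, Real.norm_eq_abs,
      mul_one, mul_one, sq_abs, sq_abs]
    simp [Real.cos_sq_add_sin_sq]
  exact (pow_eq_one_iff_of_nonneg (norm_nonneg _) two_ne_zero).1 h2

/-- The azimuth unit vector is orthogonal to `ω`. [folklore] -/
theorem inner_self_azimuth (ω : V3) (θ : ℝ) :
    ⟪ω, cos θ • Lambert.e₁ ω + sin θ • Lambert.e₂ ω⟫_ℝ = 0 := by
  rw [inner_add_right, inner_smul_right, inner_smul_right, Lambert.inner_self_e₁,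
    Lambert.inner_self_e₂, mul_zero, mul_zero, add_zero]

/-- The meridian parametrisation `(s, θ) ↦ s ω + √(1 − s²) u_θ` is continuous. [folklore] -/
theorem continuous_meridian (ω : V3) :
    Continuous fun p : ℝ × ℝ =>
      p.1 • ω + √(1 - p.1 ^ 2) • (cos p.2 • Lambert.e₁ ω + sin p.2 • Lambert.e₂ ω) := by
  fun_prop

/-- **Registered sub-goal `halfAngleSubstitution`** of crux stmt-AtomisticToContinuum-11854 (line
`Sketch`, under `stub_lambertLaw`): the half-angle substitution in term form. [folklore] -/
theorem halfAngleSubstitution :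
    ∀ K : ℝ → ENNReal, ∫⁻ t in Set.Icc (-1:ℝ) 1, K (Real.sqrt ((1 + t) / 2)) =
      ∫⁻ t in Set.Icc (-1:ℝ) 1, ENNReal.ofReal (4 * max t 0) * K t :=
  setLIntegral_comp_halfAngle

end Summit.AtomisticToContinuum.HydrodynamicLimit.Theorems.LambertianContactSwapLambertianEulerGaussianFrame

end
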